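import Mathlib
import HarnessLib
import Summits.Ventures.LatticeQCDFlow.Exactness.WilsonUniformJitterHMC
import Summits.Ventures.LatticeQCDFlow.Scoring.ChainEDFBandMinorised
import Summits.Ventures.LatticeQCDFlow.Scoring.BatchMeansConsistencyRate
import Summits.Ventures.LatticeQCDFlow.Scoring.BatchMeansStrongConsistency

/-!
# Finite-sample guarantees of a run of the engine's jittered `SU(N)` HMC AS RUN (uniform `tau_jitter` law) from EVERY start: Hoeffding tails, uniform EDF bands, bracketed quantiles, and the quality of the batch-means error bar — whenever `τ(1 − j) < τ₀`

HONEST FRAMING: exact (Metropolis-corrected) sampling algorithms for lattice gauge theory;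
figures of merit are autocorrelation/cost numbers at stated couplings and volumes; no
continuum-physics claim.

Venture `LatticeQCDFlow` (cell pub-lqcd), topic `Exactness`, FANOUT row 9 (eng-latcore, GEN-24; the engine
`latflow.core.hmc.HMC(f, β, 'leapfrog').trajectory(τ, nstep, tau_jitter = j)` — trajectory length `τ(1 + j(2u − 1))`,
`u ∼ U(0,1)`, `nstep` fixed — alone and inside `updates.composite_sweep(f, β, 'hmc', n_or)`).  NEW WORK of the cell over
GEN-24's `WilsonUniformJitterHMC.lean` (`uniformJitterLaw`, `wilson_uniformJitterHMC_invariant`,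
`wilson_uniformJitterHMC_certificate`, `wilson_uniformJitterHMC_exactStep_certificate`) and the generic theorems of row 8 (`Scoring/ChainEDFBandMinorised`: `chain_abs_tail_le_exp_of_nHit_minorised`, `minorised_measureReal_exists_edf_dev_ge_le`, `…_quantile_unbracketed_le`; `Scoring/BatchMeansConsistencyRate`, `Scoring/BatchMeansStrongConsistency`: `chain_batchMeans_sigmaHat_mse_le_rate_of_nHit`, `…_ae_tendsto_of_nHit`); the atom versions are GEN-23's `EngineFiniteSampleBands.lean` and `EngineBatchMeansQuality.lean`.  Nothing is cited as a fact;
no number is claimed.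

THE DIFFERENCE FROM GEN-23 (whose statements these repeat word for word for the jittered chain): the hypothesis is no
longer an ATOM `l₀` of the jitter law with a short trajectory (constant carrying `η{l₀}` — `2⁻⁵³` for the code's
uniform; none at all for the idealised law) but the engine's parameters as run: `nstep ≥ 1`, production length `τ > 0`,
jitter `0 < j ≤ 1` with `τ(1 − j) < τ₀`; `j = 1` qualifies at EVERY `τ`.

## Content (`K = wilsonJitterHMCL N d L β nstep (uniformJitterLaw τ j)`, `π = wilsonMeasure (β/N)`; every theorem:
## `∃ τ₀ > 0` on `N, d, L, β` only, then for EVERY `nstep ≥ 1`, `τ > 0`, `0 < j ≤ 1` with `τ(1 − j) < τ₀`)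

* FINITE-`N` BANDS (no burn-in assumption, the certificate's `(m, ε′)`): **`wilson_uniformJitterHMC_timeAverage_tail_le`**
  (Hoeffding tail of time averages), **`wilson_uniformJitterHMC_edf_band`** (uniform EDF band of any real observable),
  **`wilson_uniformJitterHMC_quantiles_bracketed`** (all sample quantiles bracketed),
  **`wilson_uniformJitterHMC_exactStep_timeAverage_tail_le`**, **`wilson_uniformJitterHMC_exactStep_edf_band`** (+ ANY exact step).
* QUALITY OF THE BATCH-MEANS ERROR BAR `σ̂²_BM = ab·SE²_BM`: **`wilson_uniformJitterHMC_batchMeans_mse_le_rate`** (MSE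
  `≤ K/a + K''/b²` from every start), **`wilson_uniformJitterHMC_batchMeans_ae_tendsto`** (strong consistency along
  `Σ1/a_n, Σ1/b_n² < ∞`), **`wilson_uniformJitterHMC_exactStep_batchMeans_{mse_le_rate, ae_tendsto}`**.

NOT CLAIMED: any value of `τ₀` or of the constants; anything when `τ(1 − j) ≥ τ₀`; rates beyond those stated;
unbounded observables; OMF words; floating point.
-/

noncomputable section

namespace Summit.Ventures.LatticeQCDFlow.Exactness

open MeasureTheory ProbabilityTheory ProbabilityTheory.Kernel Set Function Filter Topology
open Literature.MathematicalPhysics.QuantumFieldTheory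
open Literature.MathematicalPhysics.QuantumLattice (fundamentalRep continuous_fundamentalRep connectedSpace_specialUnitaryGroup)
open Summit.Ventures.LatticeQCDFlow.Scoring.GlivenkoCantelli
open Summit.Ventures.LatticeQCDFlow.Scoring (replicaSEsq kop)
open scoped ENNReal Matrix Matrix.Norms.Operator NNReal

set_option backward.isDefEq.respectTransparency false

/-! ## From `EngineFiniteSampleBands.lean` (GEN-23, atom version) — the uniform-law twin -/

section UniformJitter

variable {N d L : ℕ} [NeZero N] [NeZero L] (β : ℝ)

/-- **(H) HOEFFDING TAIL FOR TIME AVERAGES OF THE JITTERED ENGINE HMC, FROM EVERY START**: there is `τ₀ > 0`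
(depending on `N, d, L, β` only) such that whenever `nstep ≥ 1`, `τ > 0`, `0 < j ≤ 1` and
`τ(1 − j) < τ₀`, there are `m > 0` and `0 < ε′ ≤ 1` with: for every bounded measurable `f`
(`|f| ≤ C`), every initial law `μ₀`, every `N ≠ 0` and every `s` with `N s ≥ 4 m (C + |π f|)/ε′`,
`P_{μ₀}(s ≤ |A_N f − π f|) ≤ 2 exp(−(N s − 4 m (C + |π f|)/ε′)² / (8 N m² (C + |π f|)²/ε′²))`. -/
theorem wilson_uniformJitterHMC_timeAverage_tail_le :
    ∃ τ₀ : ℝ, 0 < τ₀ ∧ ∀ (nstep : ℕ) (τ j : ℝ), 1 ≤ nstep → 0 < τ → 0 < j → j ≤ 1 → τ * (1 - j) < τ₀ →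
      ∃ m : ℕ, ∃ ε' : ℝ≥0∞, 0 < m ∧ 0 < ε' ∧ ε' ≤ 1 ∧
      ∀ (f : GaugeConfig d L (Matrix.specialUnitaryGroup (Fin N) ℂ) → ℝ), Measurable f → ∀ C : ℝ, (∀ U, |f U| ≤ C) →
      ∀ (μ₀ : Measure (GaugeConfig d L (Matrix.specialUnitaryGroup (Fin N) ℂ))) [IsProbabilityMeasure μ₀] (n : ℕ), n ≠ 0 →
      ∀ s : ℝ, 4 * m * (C + |∫ z, f z ∂(wilsonMeasure (d := d) (L := L) (fundamentalRep (Fin N)) (β / N))|) / ε'.toReal ≤ n * s →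
        (Kernel.trajMeasure (X := fun _ : ℕ => GaugeConfig d L (Matrix.specialUnitaryGroup (Fin N) ℂ)) μ₀
              (fun k : ℕ => (wilsonJitterHMCL N d L β nstep (uniformJitterLaw τ j)).comap
                (fun h : (i : ↥(Finset.Iic k)) → GaugeConfig d L (Matrix.specialUnitaryGroup (Fin N) ℂ) =>
                  h ⟨k, Finset.mem_Iic.2 le_rfl⟩) (measurable_pi_apply _))).real
            {x | s ≤ |(∑ i ∈ Finset.range n, f (x i)) / n
                - ∫ z, f z ∂(wilsonMeasure (d := d) (L := L) (fundamentalRep (Fin N)) (β / N))|}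
          ≤ 2 * Real.exp (-(n * s - 4 * m * (C + |∫ z, f z ∂(wilsonMeasure (d := d) (L := L) (fundamentalRep (Fin N)) (β / N))|)
                / ε'.toReal) ^ 2
              / (8 * n * (m : ℝ) ^ 2 * (C + |∫ z, f z ∂(wilsonMeasure (d := d) (L := L) (fundamentalRep (Fin N)) (β / N))|) ^ 2
                / ε'.toReal ^ 2)) := by
  obtain ⟨τ₀, hτ₀, h⟩ := wilson_uniformJitterHMC_certificate (N := N) (d := d) (L := L) β
  refine ⟨τ₀, hτ₀, fun nstep τ j hn hτ hj hj1 hshort => ?_⟩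
  obtain ⟨m, ε', hm, hε0, hε1, hmin⟩ := h nstep τ j hn hτ hj hj1 hshort
  refine ⟨m, ε', hm, hε0, hε1, fun f hf C hC μ₀ _ n hn0 s hs => ?_⟩
  exact chain_abs_tail_le_exp_of_nHit_minorised (μ₀ := μ₀)
    (wilson_uniformJitterHMC_invariant (N := N) (d := d) (L := L) β nstep τ j)
    (GeneralNCMC.minorised_setwise hmin) hm hε0 hε1 hf hC hn0 hs

/-- **(E) UNIFORM EDF BAND FOR ANY REAL OBSERVABLE OF THE JITTERED ENGINE HMC, FROM EVERY START**: same `τ₀`,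
`m`, `ε′`; `O` measurable (the plaquette, a Polyakov loop, the topological charge — atoms allowed), grid `K ≥ 1`,
`δ > 0`, `N ≠ 0`, `N δ ≥ 8 m/ε′`:
`P_{μ₀}(∃ t, δ + 1/K ≤ |F_π(t) − F̂_N(t)|) ≤ 4 (K + 1) exp(−(N δ − 8 m/ε′)²/(32 N m²/ε′²))`. -/
theorem wilson_uniformJitterHMC_edf_band :
    ∃ τ₀ : ℝ, 0 < τ₀ ∧ ∀ (nstep : ℕ) (τ j : ℝ), 1 ≤ nstep → 0 < τ → 0 < j → j ≤ 1 → τ * (1 - j) < τ₀ →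
      ∃ m : ℕ, ∃ ε' : ℝ≥0∞, 0 < m ∧ 0 < ε' ∧ ε' ≤ 1 ∧
      ∀ (O : GaugeConfig d L (Matrix.specialUnitaryGroup (Fin N) ℂ) → ℝ), Measurable O →
      ∀ (μ₀ : Measure (GaugeConfig d L (Matrix.specialUnitaryGroup (Fin N) ℂ))) [IsProbabilityMeasure μ₀]
        (K : ℕ), 1 ≤ K → ∀ (n : ℕ), n ≠ 0 → ∀ δ : ℝ, 0 < δ → 8 * m / ε'.toReal ≤ n * δ →
        (Kernel.trajMeasure (X := fun _ : ℕ => GaugeConfig d L (Matrix.specialUnitaryGroup (Fin N) ℂ)) μ₀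
              (fun k : ℕ => (wilsonJitterHMCL N d L β nstep (uniformJitterLaw τ j)).comap
                (fun h : (i : ↥(Finset.Iic k)) → GaugeConfig d L (Matrix.specialUnitaryGroup (Fin N) ℂ) =>
                  h ⟨k, Finset.mem_Iic.2 le_rfl⟩) (measurable_pi_apply _))).real
            {x | ∃ t : ℝ, δ + 1 / K ≤ |cdf ((wilsonMeasure (d := d) (L := L) (fundamentalRep (Fin N)) (β / N)).map O) t
                - (∑ i ∈ Finset.range n, (Set.Iic t).indicator (1 : ℝ → ℝ) (O (x i))) / n|}
          ≤ 4 * ((K : ℝ) + 1) * Real.exp (-(n * δ - 8 * m / ε'.toReal) ^ 2 / (32 * n * (m : ℝ) ^ 2 / ε'.toReal ^ 2)) := by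
  obtain ⟨τ₀, hτ₀, h⟩ := wilson_uniformJitterHMC_certificate (N := N) (d := d) (L := L) β
  refine ⟨τ₀, hτ₀, fun nstep τ j hn hτ hj hj1 hshort => ?_⟩
  obtain ⟨m, ε', hm, hε0, hε1, hmin⟩ := h nstep τ j hn hτ hj hj1 hshort
  refine ⟨m, ε', hm, hε0, hε1, fun O hO μ₀ _ K hK n hn0 δ hδ0 hδ => ?_⟩
  exact minorised_measureReal_exists_edf_dev_ge_le (μ₀ := μ₀)
    (wilson_uniformJitterHMC_invariant (N := N) (d := d) (L := L) β nstep τ j)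
    (GeneralNCMC.minorised_setwise hmin) hm hε0 hε1 hO hK hn0 hδ0 hδ

/-- **(Q) ALL SAMPLE QUANTILES OF ANY REAL OBSERVABLE OF THE JITTERED ENGINE HMC AT ONCE, FROM EVERY START**: same
`τ₀`, `m`, `ε′`; `O` measurable, `η > 0`, `N ≠ 0`, `N η ≥ 16 m/ε′`: the probability that some empirical quantile
`q̂_N(u)`, `u ∈ (η, 1 − η)`, falls outside `[q_π(u − η), q_π(u + η)]` is
`≤ 4 (⌈2/η⌉ + 1) exp(−(N η − 16 m/ε′)²/(128 N m²/ε′²))`. -/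
theorem wilson_uniformJitterHMC_quantiles_bracketed :
    ∃ τ₀ : ℝ, 0 < τ₀ ∧ ∀ (nstep : ℕ) (τ j : ℝ), 1 ≤ nstep → 0 < τ → 0 < j → j ≤ 1 → τ * (1 - j) < τ₀ →
      ∃ m : ℕ, ∃ ε' : ℝ≥0∞, 0 < m ∧ 0 < ε' ∧ ε' ≤ 1 ∧
      ∀ (O : GaugeConfig d L (Matrix.specialUnitaryGroup (Fin N) ℂ) → ℝ), Measurable O →
      ∀ (μ₀ : Measure (GaugeConfig d L (Matrix.specialUnitaryGroup (Fin N) ℂ))) [IsProbabilityMeasure μ₀]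
        (n : ℕ), n ≠ 0 → ∀ θ : ℝ, 0 < θ → 16 * m / ε'.toReal ≤ n * θ →
        (Kernel.trajMeasure (X := fun _ : ℕ => GaugeConfig d L (Matrix.specialUnitaryGroup (Fin N) ℂ)) μ₀
              (fun k : ℕ => (wilsonJitterHMCL N d L β nstep (uniformJitterLaw τ j)).comap
                (fun h : (i : ↥(Finset.Iic k)) → GaugeConfig d L (Matrix.specialUnitaryGroup (Fin N) ℂ) =>
                  h ⟨k, Finset.mem_Iic.2 le_rfl⟩) (measurable_pi_apply _))).real
            {x | ∃ u : ℝ, θ < u ∧ u + θ < 1 ∧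
              ¬ (sInf {y | u - θ ≤ cdf ((wilsonMeasure (d := d) (L := L) (fundamentalRep (Fin N)) (β / N)).map O) y}
                    ≤ sInf {y | u ≤ cdf (((n : ℝ≥0∞)⁻¹) • ∑ i ∈ Finset.range n, Measure.dirac (O (x i))) y}
                  ∧ sInf {y | u ≤ cdf (((n : ℝ≥0∞)⁻¹) • ∑ i ∈ Finset.range n, Measure.dirac (O (x i))) y}
                    ≤ sInf {y | u + θ ≤ cdf ((wilsonMeasure (d := d) (L := L) (fundamentalRep (Fin N)) (β / N)).map O) y})}
          ≤ 4 * ((⌈2 / θ⌉₊ : ℝ) + 1)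
              * Real.exp (-(n * θ - 16 * m / ε'.toReal) ^ 2 / (128 * n * (m : ℝ) ^ 2 / ε'.toReal ^ 2)) := by
  obtain ⟨τ₀, hτ₀, h⟩ := wilson_uniformJitterHMC_certificate (N := N) (d := d) (L := L) β
  refine ⟨τ₀, hτ₀, fun nstep τ j hn hτ hj hj1 hshort => ?_⟩
  obtain ⟨m, ε', hm, hε0, hε1, hmin⟩ := h nstep τ j hn hτ hj hj1 hshort
  refine ⟨m, ε', hm, hε0, hε1, fun O hO μ₀ _ n hn0 θ hθ hnθ => ?_⟩
  exact minorised_measureReal_exists_quantile_unbracketed_le (μ₀ := μ₀)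
    (wilson_uniformJitterHMC_invariant (N := N) (d := d) (L := L) β nstep τ j)
    (GeneralNCMC.minorised_setwise hmin) hm hε0 hε1 hO hn0 hθ hnθ

/-! ## §2 The jittered `'hmc'` path followed by ANY exact step -/

/-- **(H) FOR THE COMPOSITE `P ∘ K_jit`** — `P` ANY Markov kernel leaving `wilsonMeasure (β/N)` invariant; same shape,
from every start. -/
theorem wilson_uniformJitterHMC_exactStep_timeAverage_tail_le :
    ∃ τ₀ : ℝ, 0 < τ₀ ∧ ∀ (nstep : ℕ) (τ j : ℝ), 1 ≤ nstep → 0 < τ → 0 < j → j ≤ 1 → τ * (1 - j) < τ₀ →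
      ∀ (P : Kernel (GaugeConfig d L (Matrix.specialUnitaryGroup (Fin N) ℂ)) (GaugeConfig d L (Matrix.specialUnitaryGroup (Fin N) ℂ)))
        [IsMarkovKernel P], Invariant P (wilsonMeasure (d := d) (L := L) (fundamentalRep (Fin N)) (β / N)) →
      ∃ m : ℕ, ∃ ε' : ℝ≥0∞, 0 < m ∧ 0 < ε' ∧ ε' ≤ 1 ∧
      ∀ (f : GaugeConfig d L (Matrix.specialUnitaryGroup (Fin N) ℂ) → ℝ), Measurable f → ∀ C : ℝ, (∀ U, |f U| ≤ C) →
      ∀ (μ₀ : Measure (GaugeConfig d L (Matrix.specialUnitaryGroup (Fin N) ℂ))) [IsProbabilityMeasure μ₀] (n : ℕ), n ≠ 0 →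
      ∀ s : ℝ, 4 * m * (C + |∫ z, f z ∂(wilsonMeasure (d := d) (L := L) (fundamentalRep (Fin N)) (β / N))|) / ε'.toReal ≤ n * s →
        (Kernel.trajMeasure (X := fun _ : ℕ => GaugeConfig d L (Matrix.specialUnitaryGroup (Fin N) ℂ)) μ₀
              (fun k : ℕ => (P ∘ₖ wilsonJitterHMCL N d L β nstep (uniformJitterLaw τ j)).comap
                (fun h : (i : ↥(Finset.Iic k)) → GaugeConfig d L (Matrix.specialUnitaryGroup (Fin N) ℂ) =>
                  h ⟨k, Finset.mem_Iic.2 le_rfl⟩) (measurable_pi_apply _))).real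
            {x | s ≤ |(∑ i ∈ Finset.range n, f (x i)) / n
                - ∫ z, f z ∂(wilsonMeasure (d := d) (L := L) (fundamentalRep (Fin N)) (β / N))|}
          ≤ 2 * Real.exp (-(n * s - 4 * m * (C + |∫ z, f z ∂(wilsonMeasure (d := d) (L := L) (fundamentalRep (Fin N)) (β / N))|)
                / ε'.toReal) ^ 2
              / (8 * n * (m : ℝ) ^ 2 * (C + |∫ z, f z ∂(wilsonMeasure (d := d) (L := L) (fundamentalRep (Fin N)) (β / N))|) ^ 2
                / ε'.toReal ^ 2)) := by
  obtain ⟨τ₀, hτ₀, h⟩ := wilson_uniformJitterHMC_exactStep_certificate (N := N) (d := d) (L := L) β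
  refine ⟨τ₀, hτ₀, fun nstep τ j hn hτ hj hj1 hshort P _ hP => ?_⟩
  obtain ⟨hinv, m, ε', hm, hε0, hε1, hmin⟩ := h nstep τ j hn hτ hj hj1 hshort P hP
  haveI := isMarkovKernel_wilsonJitterHMCL (N := N) (d := d) (L := L) β nstep (uniformJitterLaw τ j)
  refine ⟨m, ε', hm, hε0, hε1, fun f hf C hC μ₀ _ n hn0 s hs => ?_⟩
  exact chain_abs_tail_le_exp_of_nHit_minorised (μ₀ := μ₀) hinv
    (GeneralNCMC.minorised_setwise hmin) hm hε0 hε1 hf hC hn0 hs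

/-- **(E) FOR THE COMPOSITE `P ∘ K_jit`**: the uniform EDF band of any real observable, from every start. -/
theorem wilson_uniformJitterHMC_exactStep_edf_band :
    ∃ τ₀ : ℝ, 0 < τ₀ ∧ ∀ (nstep : ℕ) (τ j : ℝ), 1 ≤ nstep → 0 < τ → 0 < j → j ≤ 1 → τ * (1 - j) < τ₀ →
      ∀ (P : Kernel (GaugeConfig d L (Matrix.specialUnitaryGroup (Fin N) ℂ)) (GaugeConfig d L (Matrix.specialUnitaryGroup (Fin N) ℂ)))
        [IsMarkovKernel P], Invariant P (wilsonMeasure (d := d) (L := L) (fundamentalRep (Fin N)) (β / N)) →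
      ∃ m : ℕ, ∃ ε' : ℝ≥0∞, 0 < m ∧ 0 < ε' ∧ ε' ≤ 1 ∧
      ∀ (O : GaugeConfig d L (Matrix.specialUnitaryGroup (Fin N) ℂ) → ℝ), Measurable O →
      ∀ (μ₀ : Measure (GaugeConfig d L (Matrix.specialUnitaryGroup (Fin N) ℂ))) [IsProbabilityMeasure μ₀]
        (K : ℕ), 1 ≤ K → ∀ (n : ℕ), n ≠ 0 → ∀ δ : ℝ, 0 < δ → 8 * m / ε'.toReal ≤ n * δ →
        (Kernel.trajMeasure (X := fun _ : ℕ => GaugeConfig d L (Matrix.specialUnitaryGroup (Fin N) ℂ)) μ₀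
              (fun k : ℕ => (P ∘ₖ wilsonJitterHMCL N d L β nstep (uniformJitterLaw τ j)).comap
                (fun h : (i : ↥(Finset.Iic k)) → GaugeConfig d L (Matrix.specialUnitaryGroup (Fin N) ℂ) =>
                  h ⟨k, Finset.mem_Iic.2 le_rfl⟩) (measurable_pi_apply _))).real
            {x | ∃ t : ℝ, δ + 1 / K ≤ |cdf ((wilsonMeasure (d := d) (L := L) (fundamentalRep (Fin N)) (β / N)).map O) t
                - (∑ i ∈ Finset.range n, (Set.Iic t).indicator (1 : ℝ → ℝ) (O (x i))) / n|}
          ≤ 4 * ((K : ℝ) + 1) * Real.exp (-(n * δ - 8 * m / ε'.toReal) ^ 2 / (32 * n * (m : ℝ) ^ 2 / ε'.toReal ^ 2)) := by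
  obtain ⟨τ₀, hτ₀, h⟩ := wilson_uniformJitterHMC_exactStep_certificate (N := N) (d := d) (L := L) β
  refine ⟨τ₀, hτ₀, fun nstep τ j hn hτ hj hj1 hshort P _ hP => ?_⟩
  obtain ⟨hinv, m, ε', hm, hε0, hε1, hmin⟩ := h nstep τ j hn hτ hj hj1 hshort P hP
  haveI := isMarkovKernel_wilsonJitterHMCL (N := N) (d := d) (L := L) β nstep (uniformJitterLaw τ j)
  refine ⟨m, ε', hm, hε0, hε1, fun O hO μ₀ _ K hK n hn0 δ hδ0 hδ => ?_⟩
  exact minorised_measureReal_exists_edf_dev_ge_le (μ₀ := μ₀) hinv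
    (GeneralNCMC.minorised_setwise hmin) hm hε0 hε1 hO hK hn0 hδ0 hδ

end UniformJitter

/-! ## From `EngineBatchMeansQuality.lean` (GEN-23, atom version) — the uniform-law twin -/

section UniformJitter

variable {N d L : ℕ} [NeZero N] [NeZero L] (β : ℝ)

/-- **(R) MSE RATE OF THE BATCH-MEANS ERROR BAR OF THE JITTERED ENGINE HMC, FROM EVERY START**: there is `τ₀ > 0`
(depending on `N, d, L, β` only) such that whenever `nstep ≥ 1`, `τ > 0`, `0 < j ≤ 1` and
`τ(1 − j) < τ₀`, for every bounded measurable `f` there are `K, K''` with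
`E_{μ₀}[(a b · SE²_BM − σ²_f)²] ≤ K/a + K''/b²` for every initial law `μ₀`, every `a ≥ 2`, `b ≠ 0`. -/
theorem wilson_uniformJitterHMC_batchMeans_mse_le_rate :
    ∃ τ₀ : ℝ, 0 < τ₀ ∧ ∀ (nstep : ℕ) (τ j : ℝ), 1 ≤ nstep → 0 < τ → 0 < j → j ≤ 1 → τ * (1 - j) < τ₀ →
      ∀ (f : GaugeConfig d L (Matrix.specialUnitaryGroup (Fin N) ℂ) → ℝ), Measurable f → ∀ C : ℝ, (∀ U, |f U| ≤ C) →
      ∃ K K'' : ℝ, ∀ (μ₀ : Measure (GaugeConfig d L (Matrix.specialUnitaryGroup (Fin N) ℂ))) [IsProbabilityMeasure μ₀]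
        (a b : ℕ), 2 ≤ a → b ≠ 0 →
        ∫ x, (((b * a : ℕ) : ℝ)
            * replicaSEsq (fun j (x : ℕ → GaugeConfig d L (Matrix.specialUnitaryGroup (Fin N) ℂ)) =>
                (∑ i ∈ Finset.range b, f (x (b * j + i))) / b) a x
            - ((∫ y, (f y - ∫ z, f z ∂(wilsonMeasure (d := d) (L := L) (fundamentalRep (Fin N)) (β / N))) ^ 2
                  ∂(wilsonMeasure (d := d) (L := L) (fundamentalRep (Fin N)) (β / N)))
              + 2 * ∑' k, ∫ y, (f y - ∫ z, f z ∂(wilsonMeasure (d := d) (L := L) (fundamentalRep (Fin N)) (β / N)))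
                * (kop (wilsonJitterHMCL N d L β nstep (uniformJitterLaw τ j)))^[k + 1]
                    (fun y => f y - ∫ z, f z ∂(wilsonMeasure (d := d) (L := L) (fundamentalRep (Fin N)) (β / N))) y
                  ∂(wilsonMeasure (d := d) (L := L) (fundamentalRep (Fin N)) (β / N)))) ^ 2
          ∂(Kernel.trajMeasure (X := fun _ : ℕ => GaugeConfig d L (Matrix.specialUnitaryGroup (Fin N) ℂ)) μ₀
              (fun n : ℕ => (wilsonJitterHMCL N d L β nstep (uniformJitterLaw τ j)).comap
                (fun h : (i : ↥(Finset.Iic n)) → GaugeConfig d L (Matrix.specialUnitaryGroup (Fin N) ℂ) =>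
                  h ⟨n, Finset.mem_Iic.2 le_rfl⟩) (measurable_pi_apply _)))
          ≤ K / a + K'' / (b : ℝ) ^ 2 := by
  obtain ⟨τ₀, hτ₀, h⟩ := wilson_uniformJitterHMC_certificate (N := N) (d := d) (L := L) β
  refine ⟨τ₀, hτ₀, fun nstep τ j hn hτ hj hj1 hshort f hf C hC => ?_⟩
  obtain ⟨m, ε', hm, hε0, hε1, hmin⟩ := h nstep τ j hn hτ hj hj1 hshort
  exact Scoring.chain_batchMeans_sigmaHat_mse_le_rate_of_nHit
    (wilson_uniformJitterHMC_invariant (N := N) (d := d) (L := L) β nstep τ j)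
    (GeneralNCMC.minorised_setwise hmin) hε0 hε1 hm hf hC

/-- **(S) STRONG CONSISTENCY OF THE BATCH-MEANS ERROR BAR OF THE JITTERED ENGINE HMC, FROM EVERY START**: same `τ₀`;
for `|f| ≤ C` measurable, every initial law `μ₀` and every schedule `a_n ≥ 2`, `b_n ≠ 0` with `Σ 1/a_n < ∞`,
`Σ 1/b_n² < ∞`: `a_n b_n · SE²_BM → σ²_f` `P_{μ₀}`-almost surely. -/
theorem wilson_uniformJitterHMC_batchMeans_ae_tendsto :
    ∃ τ₀ : ℝ, 0 < τ₀ ∧ ∀ (nstep : ℕ) (τ j : ℝ), 1 ≤ nstep → 0 < τ → 0 < j → j ≤ 1 → τ * (1 - j) < τ₀ →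
      ∀ (f : GaugeConfig d L (Matrix.specialUnitaryGroup (Fin N) ℂ) → ℝ), Measurable f → ∀ C : ℝ, (∀ U, |f U| ≤ C) →
      ∀ (μ₀ : Measure (GaugeConfig d L (Matrix.specialUnitaryGroup (Fin N) ℂ))) [IsProbabilityMeasure μ₀] (a b : ℕ → ℕ),
        (∀ n, 2 ≤ a n) → (∀ n, b n ≠ 0) → (Summable fun n => (1 : ℝ) / (a n : ℝ)) →
        (Summable fun n => (1 : ℝ) / ((b n : ℝ) ^ 2)) →
        ∀ᵐ x ∂(Kernel.trajMeasure (X := fun _ : ℕ => GaugeConfig d L (Matrix.specialUnitaryGroup (Fin N) ℂ)) μ₀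
              (fun n : ℕ => (wilsonJitterHMCL N d L β nstep (uniformJitterLaw τ j)).comap
                (fun h : (i : ↥(Finset.Iic n)) → GaugeConfig d L (Matrix.specialUnitaryGroup (Fin N) ℂ) =>
                  h ⟨n, Finset.mem_Iic.2 le_rfl⟩) (measurable_pi_apply _))),
          Tendsto (fun n : ℕ => ((b n * a n : ℕ) : ℝ)
            * replicaSEsq (fun j (x : ℕ → GaugeConfig d L (Matrix.specialUnitaryGroup (Fin N) ℂ)) =>
                (∑ i ∈ Finset.range (b n), f (x (b n * j + i))) / (b n)) (a n) x) atTop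
            (nhds ((∫ y, (f y - ∫ z, f z ∂(wilsonMeasure (d := d) (L := L) (fundamentalRep (Fin N)) (β / N))) ^ 2
                  ∂(wilsonMeasure (d := d) (L := L) (fundamentalRep (Fin N)) (β / N)))
              + 2 * ∑' k, ∫ y, (f y - ∫ z, f z ∂(wilsonMeasure (d := d) (L := L) (fundamentalRep (Fin N)) (β / N)))
                * (kop (wilsonJitterHMCL N d L β nstep (uniformJitterLaw τ j)))^[k + 1]
                    (fun y => f y - ∫ z, f z ∂(wilsonMeasure (d := d) (L := L) (fundamentalRep (Fin N)) (β / N))) y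
                  ∂(wilsonMeasure (d := d) (L := L) (fundamentalRep (Fin N)) (β / N)))) := by
  obtain ⟨τ₀, hτ₀, h⟩ := wilson_uniformJitterHMC_certificate (N := N) (d := d) (L := L) β
  refine ⟨τ₀, hτ₀, fun nstep τ j hn hτ hj hj1 hshort f hf C hC μ₀ _ a b ha2 hb0 hsa hsb => ?_⟩
  obtain ⟨m, ε', hm, hε0, hε1, hmin⟩ := h nstep τ j hn hτ hj hj1 hshort
  exact Scoring.chain_batchMeans_sigmaHat_ae_tendsto_of_nHit
    (wilson_uniformJitterHMC_invariant (N := N) (d := d) (L := L) β nstep τ j)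
    (GeneralNCMC.minorised_setwise hmin) hε0 hε1 hm hf hC μ₀ ha2 hb0 hsa hsb

/-! ## §2 The jittered `'hmc'` path followed by ANY exact step -/

/-- **(R) FOR THE COMPOSITE `P ∘ K_jit`** — `P` ANY Markov kernel leaving `wilsonMeasure (β/N)` invariant: the MSE
rate `K/a + K''/b²` of the batch-means error bar, from every start. -/
theorem wilson_uniformJitterHMC_exactStep_batchMeans_mse_le_rate :
    ∃ τ₀ : ℝ, 0 < τ₀ ∧ ∀ (nstep : ℕ) (τ j : ℝ), 1 ≤ nstep → 0 < τ → 0 < j → j ≤ 1 → τ * (1 - j) < τ₀ →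
      ∀ (P : Kernel (GaugeConfig d L (Matrix.specialUnitaryGroup (Fin N) ℂ)) (GaugeConfig d L (Matrix.specialUnitaryGroup (Fin N) ℂ)))
        [IsMarkovKernel P], Invariant P (wilsonMeasure (d := d) (L := L) (fundamentalRep (Fin N)) (β / N)) →
      ∀ (f : GaugeConfig d L (Matrix.specialUnitaryGroup (Fin N) ℂ) → ℝ), Measurable f → ∀ C : ℝ, (∀ U, |f U| ≤ C) →
      ∃ K K'' : ℝ, ∀ (μ₀ : Measure (GaugeConfig d L (Matrix.specialUnitaryGroup (Fin N) ℂ))) [IsProbabilityMeasure μ₀]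
        (a b : ℕ), 2 ≤ a → b ≠ 0 →
        ∫ x, (((b * a : ℕ) : ℝ)
            * replicaSEsq (fun j (x : ℕ → GaugeConfig d L (Matrix.specialUnitaryGroup (Fin N) ℂ)) =>
                (∑ i ∈ Finset.range b, f (x (b * j + i))) / b) a x
            - ((∫ y, (f y - ∫ z, f z ∂(wilsonMeasure (d := d) (L := L) (fundamentalRep (Fin N)) (β / N))) ^ 2
                  ∂(wilsonMeasure (d := d) (L := L) (fundamentalRep (Fin N)) (β / N)))
              + 2 * ∑' k, ∫ y, (f y - ∫ z, f z ∂(wilsonMeasure (d := d) (L := L) (fundamentalRep (Fin N)) (β / N)))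
                * (kop (P ∘ₖ wilsonJitterHMCL N d L β nstep (uniformJitterLaw τ j)))^[k + 1]
                    (fun y => f y - ∫ z, f z ∂(wilsonMeasure (d := d) (L := L) (fundamentalRep (Fin N)) (β / N))) y
                  ∂(wilsonMeasure (d := d) (L := L) (fundamentalRep (Fin N)) (β / N)))) ^ 2
          ∂(Kernel.trajMeasure (X := fun _ : ℕ => GaugeConfig d L (Matrix.specialUnitaryGroup (Fin N) ℂ)) μ₀
              (fun n : ℕ => (P ∘ₖ wilsonJitterHMCL N d L β nstep (uniformJitterLaw τ j)).comap
                (fun h : (i : ↥(Finset.Iic n)) → GaugeConfig d L (Matrix.specialUnitaryGroup (Fin N) ℂ) =>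
                  h ⟨n, Finset.mem_Iic.2 le_rfl⟩) (measurable_pi_apply _)))
          ≤ K / a + K'' / (b : ℝ) ^ 2 := by
  obtain ⟨τ₀, hτ₀, h⟩ := wilson_uniformJitterHMC_exactStep_certificate (N := N) (d := d) (L := L) β
  refine ⟨τ₀, hτ₀, fun nstep τ j hn hτ hj hj1 hshort P _ hP f hf C hC => ?_⟩
  obtain ⟨hinv, m, ε', hm, hε0, hε1, hmin⟩ := h nstep τ j hn hτ hj hj1 hshort P hP
  haveI := isMarkovKernel_wilsonJitterHMCL (N := N) (d := d) (L := L) β nstep (uniformJitterLaw τ j)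
  exact Scoring.chain_batchMeans_sigmaHat_mse_le_rate_of_nHit hinv
    (GeneralNCMC.minorised_setwise hmin) hε0 hε1 hm hf hC

/-- **(S) FOR THE COMPOSITE `P ∘ K_jit`**: strong consistency of the batch-means error bar along every schedule with
`Σ 1/a_n < ∞`, `Σ 1/b_n² < ∞`, from every start. -/
theorem wilson_uniformJitterHMC_exactStep_batchMeans_ae_tendsto :
    ∃ τ₀ : ℝ, 0 < τ₀ ∧ ∀ (nstep : ℕ) (τ j : ℝ), 1 ≤ nstep → 0 < τ → 0 < j → j ≤ 1 → τ * (1 - j) < τ₀ →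
      ∀ (P : Kernel (GaugeConfig d L (Matrix.specialUnitaryGroup (Fin N) ℂ)) (GaugeConfig d L (Matrix.specialUnitaryGroup (Fin N) ℂ)))
        [IsMarkovKernel P], Invariant P (wilsonMeasure (d := d) (L := L) (fundamentalRep (Fin N)) (β / N)) →
      ∀ (f : GaugeConfig d L (Matrix.specialUnitaryGroup (Fin N) ℂ) → ℝ), Measurable f → ∀ C : ℝ, (∀ U, |f U| ≤ C) →
      ∀ (μ₀ : Measure (GaugeConfig d L (Matrix.specialUnitaryGroup (Fin N) ℂ))) [IsProbabilityMeasure μ₀] (a b : ℕ → ℕ),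
        (∀ n, 2 ≤ a n) → (∀ n, b n ≠ 0) → (Summable fun n => (1 : ℝ) / (a n : ℝ)) →
        (Summable fun n => (1 : ℝ) / ((b n : ℝ) ^ 2)) →
        ∀ᵐ x ∂(Kernel.trajMeasure (X := fun _ : ℕ => GaugeConfig d L (Matrix.specialUnitaryGroup (Fin N) ℂ)) μ₀
              (fun n : ℕ => (P ∘ₖ wilsonJitterHMCL N d L β nstep (uniformJitterLaw τ j)).comap
                (fun h : (i : ↥(Finset.Iic n)) → GaugeConfig d L (Matrix.specialUnitaryGroup (Fin N) ℂ) =>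
                  h ⟨n, Finset.mem_Iic.2 le_rfl⟩) (measurable_pi_apply _))),
          Tendsto (fun n : ℕ => ((b n * a n : ℕ) : ℝ)
            * replicaSEsq (fun j (x : ℕ → GaugeConfig d L (Matrix.specialUnitaryGroup (Fin N) ℂ)) =>
                (∑ i ∈ Finset.range (b n), f (x (b n * j + i))) / (b n)) (a n) x) atTop
            (nhds ((∫ y, (f y - ∫ z, f z ∂(wilsonMeasure (d := d) (L := L) (fundamentalRep (Fin N)) (β / N))) ^ 2
                  ∂(wilsonMeasure (d := d) (L := L) (fundamentalRep (Fin N)) (β / N)))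
              + 2 * ∑' k, ∫ y, (f y - ∫ z, f z ∂(wilsonMeasure (d := d) (L := L) (fundamentalRep (Fin N)) (β / N)))
                * (kop (P ∘ₖ wilsonJitterHMCL N d L β nstep (uniformJitterLaw τ j)))^[k + 1]
                    (fun y => f y - ∫ z, f z ∂(wilsonMeasure (d := d) (L := L) (fundamentalRep (Fin N)) (β / N))) y
                  ∂(wilsonMeasure (d := d) (L := L) (fundamentalRep (Fin N)) (β / N)))) := by
  obtain ⟨τ₀, hτ₀, h⟩ := wilson_uniformJitterHMC_exactStep_certificate (N := N) (d := d) (L := L) β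
  refine ⟨τ₀, hτ₀, fun nstep τ j hn hτ hj hj1 hshort P _ hP f hf C hC μ₀ _ a b ha2 hb0 hsa hsb => ?_⟩
  obtain ⟨hinv, m, ε', hm, hε0, hε1, hmin⟩ := h nstep τ j hn hτ hj hj1 hshort P hP
  haveI := isMarkovKernel_wilsonJitterHMCL (N := N) (d := d) (L := L) β nstep (uniformJitterLaw τ j)
  exact Scoring.chain_batchMeans_sigmaHat_ae_tendsto_of_nHit hinv
    (GeneralNCMC.minorised_setwise hmin) hε0 hε1 hm hf hC μ₀ ha2 hb0 hsa hsb

end UniformJitter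

end Summit.Ventures.LatticeQCDFlow.Exactness
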